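import Mathlib
import Literature.Analysis.FunctionSpaces.PoissonPointProcess
import Literature.Analysis.FunctionSpaces.PoissonMecke
import Literature.Analysis.FunctionSpaces.PoissonSuperpositionProofs
import Literature.Analysis.FunctionSpaces.PointConfigFactorialMeasure
import Summits.CriticalPhenomena.CardyFormulaZ2.Theorems.CardyFlipRussoSquareFromVoronoiHubSmallCellsPart1
import Summits.CriticalPhenomena.CardyFormulaZ2.Theorems.CardyFlipRussoSquareFromVoronoiHubFaithfulDefs
import Summits.CriticalPhenomena.CardyFormulaZ2.Theorems.CardyFlipRussoSquareFromVoronoiHubNoDefectPart1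
import Summits.CriticalPhenomena.CardyFormulaZ2.Theorems.CardyFlipRussoSquareFromVoronoiHubNoDefectPart2
import Summits.CriticalPhenomena.CardyFormulaZ2.Theorems.CardyFlipRussoSquareFromVoronoiHubNoDefectPart3

/-!
# Stub `stub_noDefect` (S2 of K1), line `Sketch` of crux `SquareFromVoronoiHub`:
# the bulk no-defect event of the dilated Poisson–Voronoi nuclei has probability `→ 1`

Crux `Summit.CriticalPhenomena.CardyFormulaZ2.Theses.CardyFlipRusso.SquareFromVoronoiHub`
(stmt-CriticalPhenomena-6434), line `Sketch` (card `voronoi-blocks-on-fixed-gs`), stub family K1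
("faithful discretisation"), REGISTERED STUB `stub_noDefect` (S2 of the reshaped K1, over the
vocabulary of `CardyFlipRussoSquareFromVoronoiHubFaithfulDefs`: `noDefect`, `cellRad`, `sepRad`,
`edgeLen`).  Statement: for independent Poisson(Lebesgue) black and white nuclei `PB`, `PW` and a
bounded window `V` with non-empty interior, the (outer) `PB ⊗ PW`-probability that the pair of
nucleus sets dilated by `ε = δ^{1/8}` has a defect in `V` at thresholds
`(cellRad δ, sepRad δ, edgeLen δ) = (δ^{3/32}, δ^{3/8}, δ^{5/8})` tends to `0` as `δ → 0⁺`.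

Proof (Bollobás–Riordan, *Percolation* (2006), Ch. 8 §8.3 flavour — every failure is a union over
tuples of nuclei controlled by void probabilities and first moments):
* `mem_noDefect_smul` / `not_mem_noDefect_of_smul`: every clause of `noDefect` is metric, so a
  defect of `(ε • B, ε • W)` in `V` at `(ρ, r₂, ℓ₀)` is a defect of `(B, W)` in `ε⁻¹ • V` at
  `(ρ/ε, r₂/ε, ℓ₀/ε)` — the processes are never dilated;
* `mem_noDefect_of_not_bad`: at a fixed window `W ⊆ B(0, L)` containing a disc `B(z₀, t)`, the
  defect event is covered by the five elementary bad events of Part 2 ((o) a colour void in the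
  disc, (ii') a shared nucleus, and, for the UNION of the two colour classes, (i) a point of
  `B(0, L)` at distance `≥ a` from all nuclei, (ii) an ordered pair of distinct nuclei in
  `pairWindow L b`, (iii) an ordered quadruple of distinct nuclei in `quadWindow L a l`);
* `measureReal_not_noDefect_le`: outer-measure monotonicity and subadditivity, transfer of the
  union events to the superposed Poisson process of intensity `2 · Lebesgue`
  (`superposition_holds`, `Measure.le_map_apply`), and the five bounds of Part 2 give
  `2e^{-πt²} + (4L/a + 5)² e^{-πa²/2} + 2πL² · 2πb² + 2πL² · (2π(5a)²)² · 50π a l`;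
* `measureReal_fail_le_majorant`: along the schedule, with `s = δ^{1/32}`, the rescaled data are
  `L = L₀ s⁻⁴`, `t = t₀ s⁻⁴`, `a = s⁻¹`, `b = s⁸`, `l = s¹⁶`, and the bound is below the explicit
  majorant of Part 3, which tends to `0` (`tendsto_majorant`); `squeeze_zero'` concludes.

References: B. Bollobás, O. Riordan, *Percolation* (2006), Ch. 8 §8.3; J. F. C. Kingman,
*Poisson Processes* (1993), §2.1–2.2; G. Last, M. Penrose, *Lectures on the Poisson Process*
(2017), Thm 4.4.
-/

noncomputable section

namespace Summit.CriticalPhenomena.CardyFormulaZ2.Cruxes.SquareFromVoronoiHub.VoronoiBlocks.Faithful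

open scoped Topology ENNReal Pointwise
open Set Filter MeasureTheory Metric
open Literature.Analysis.FunctionSpaces (PointConfig IsPoissonPointProcess)

namespace NoDefect

/-! ### Similarity invariance of the no-defect event -/

/-- **The no-defect event is similarity-invariant**: dilating the two nucleus sets, the window and
the three thresholds by the same `s > 0` preserves membership (every clause of `noDefect` is
metric). [folklore] -/
theorem mem_noDefect_smul {B W V : Set ℂ} {ρ r₂ ℓ₀ s : ℝ} (hs : 0 < s)
    (h : (B, W) ∈ noDefect V ρ r₂ ℓ₀) :
    ((s : ℂ) • B, (s : ℂ) • W) ∈ noDefect ((s : ℂ) • V) (s * ρ) (s * r₂) (s * ℓ₀) := by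
  have hs' : (s : ℂ) ≠ 0 := Complex.ofReal_ne_zero.2 hs.ne'
  have hsi : (s : ℂ)⁻¹ ≠ 0 := inv_ne_zero hs'
  have hd : ∀ x y : ℂ, dist ((s : ℂ)⁻¹ • x) ((s : ℂ)⁻¹ • y) = s⁻¹ * dist x y := fun x y => by
    rw [dist_smul₀, norm_inv, Complex.norm_real, Real.norm_of_nonneg hs.le]
  have hm : ∀ (A : Set ℂ) (x : ℂ), x ∈ (s : ℂ) • A ↔ (s : ℂ)⁻¹ • x ∈ A := fun A x =>
    Set.mem_smul_set_iff_inv_smul_mem₀ hs' A x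
  have hU : (s : ℂ) • B ∪ (s : ℂ) • W = (s : ℂ) • (B ∪ W) := Set.smul_set_union.symm
  have hinj : ∀ {x y : ℂ}, x ≠ y → (s : ℂ)⁻¹ • x ≠ (s : ℂ)⁻¹ • y := fun hxy h =>
    hxy (smul_right_injective ℂ hsi h)
  have hle : ∀ {x y : ℂ}, dist x y ≤ 2 * (s * ρ) → dist ((s : ℂ)⁻¹ • x) ((s : ℂ)⁻¹ • y) ≤ 2 * ρ :=
    fun {x y} hxy => by
    rw [hd]
    calc s⁻¹ * dist x y ≤ s⁻¹ * (2 * (s * ρ)) := mul_le_mul_of_nonneg_left hxy (inv_nonneg.2 hs.le)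
      _ = 2 * ρ := by field_simp
  obtain ⟨⟨hB, hW⟩, h1, h2, h3, h4⟩ := h
  simp only [noDefect, mem_setOf_eq, hU]
  refine ⟨⟨?_, ?_⟩, ?_, ?_, ?_, ?_⟩
  · obtain ⟨p, hpB, hpV⟩ := hB
    exact ⟨(s : ℂ) • p, Set.smul_mem_smul_set hpB, Set.smul_mem_smul_set hpV⟩
  · obtain ⟨p, hpW, hpV⟩ := hW
    exact ⟨(s : ℂ) • p, Set.smul_mem_smul_set hpW, Set.smul_mem_smul_set hpV⟩
  · intro z hz
    rw [hm] at hz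
    obtain ⟨p, hp, hzp⟩ := h1 _ hz
    refine ⟨(s : ℂ) • p, Set.smul_mem_smul_set hp, ?_⟩
    have e : dist z ((s : ℂ) • p) = s * dist ((s : ℂ)⁻¹ • z) p := by
      conv_lhs => rw [show z = (s : ℂ) • ((s : ℂ)⁻¹ • z) by rw [smul_inv_smul₀ hs']]
      rw [dist_smul₀, Complex.norm_real, Real.norm_of_nonneg hs.le]
    rw [e]
    exact mul_lt_mul_of_pos_left hzp hs
  · intro p hp q hq hpV hpq
    rw [hm] at hp hq hpV
    have hpq' : dist ((s : ℂ)⁻¹ • p) ((s : ℂ)⁻¹ • q) < r₂ := by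
      rw [hd]
      calc s⁻¹ * dist p q < s⁻¹ * (s * r₂) := mul_lt_mul_of_pos_left hpq (inv_pos.2 hs)
        _ = r₂ := by field_simp
    exact smul_right_injective ℂ hsi (h2 _ hp _ hq hpV hpq')
  · intro p hpV hpB hpW
    rw [hm] at hpV hpB hpW
    exact h3 _ hpV hpB hpW
  · intro p hp q hq r hr r' hr' v v' hpV hpq hpr hqr hpr' hqr' hrr' e1 e2 hv e1' e2' hv'
    rw [hm] at hp hq hr hr' hpV
    have key := h4 _ hp _ hq _ hr _ hr' ((s : ℂ)⁻¹ • v) ((s : ℂ)⁻¹ • v') hpV (hinj hpq) (hinj hpr)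
      (hinj hqr) (hinj hpr') (hinj hqr') (hinj hrr') (by rw [hd, hd, e1]) (by rw [hd, hd, e2])
      (hle hv) (by rw [hd, hd, e1']) (by rw [hd, hd, e2']) (hle hv')
    rw [hd] at key
    rwa [le_inv_mul_iff₀ hs] at key

/-- Consequence: a defect of the DILATED pair `(s • B, s • W)` in `V` at thresholds `(ρ, r₂, ℓ₀)` is
a defect of `(B, W)` in `s⁻¹ • V` at thresholds `(ρ/s, r₂/s, ℓ₀/s)`. [folklore] -/
theorem not_mem_noDefect_of_smul {B W V : Set ℂ} {ρ r₂ ℓ₀ s : ℝ} (hs : 0 < s)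
    (h : ((s : ℂ) • B, (s : ℂ) • W) ∉ noDefect V ρ r₂ ℓ₀) :
    (B, W) ∉ noDefect ((s : ℂ)⁻¹ • V) (ρ / s) (r₂ / s) (ℓ₀ / s) := by
  intro hmem
  apply h
  have hs' : (s : ℂ) ≠ 0 := Complex.ofReal_ne_zero.2 hs.ne'
  have e : ∀ x : ℝ, s * (x / s) = x := fun x => by field_simp
  have := mem_noDefect_smul hs hmem
  rwa [smul_inv_smul₀ hs', e, e, e] at this

/-! ### Injective tuples of nuclei -/

/-- Two distinct nuclei form an injective pair `Fin 2 → ℂ` (a `2`-tuple of distinct points).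
[folklore] -/
theorem injective_nuclei_two {p q : ℂ} (h : p ≠ q) :
    (![p, q] : Fin 2 → ℂ) ∈ {x | Function.Injective x} := by
  intro i j hij
  fin_cases i <;> fin_cases j <;> simp_all [eq_comm]

/-- Four pairwise distinct nuclei form an injective quadruple `Fin 4 → ℂ`. [folklore] -/
theorem injective_nuclei_four {p q r r' : ℂ}
    (h : p ≠ q ∧ p ≠ r ∧ q ≠ r ∧ p ≠ r' ∧ q ≠ r' ∧ r ≠ r') :
    (![p, q, r, r'] : Fin 4 → ℂ) ∈ {x | Function.Injective x} := by
  obtain ⟨h₁, h₂, h₃, h₄, h₅, h₆⟩ := h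
  intro i j hij
  fin_cases i <;> fin_cases j <;> simp_all [eq_comm]

/-! ### The failure event is covered by the five elementary bad events -/

/-- **Decomposition of the defect event.**  If both colours have a nucleus in the disc
`B(z₀, t) ⊆ W`, the two colour classes are disjoint, no point of `B(0, L) ⊇ W` is at distance
`≥ a` from all nuclei, and the union has no ordered pair of distinct nuclei in `pairWindow L b`
and no ordered quadruple of distinct nuclei in `quadWindow L a l`, then `(c.1, c.2)` has no
defect in `W` at thresholds `(a, b, l)`. [folklore] -/
theorem mem_noDefect_of_not_bad (c : PointConfig ℂ × PointConfig ℂ) {W : Set ℂ} {L a b l t : ℝ}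
    {z₀ : ℂ} (hWL : W ⊆ ball (0 : ℂ) L) (hD : ball z₀ t ⊆ W)
    (ho : c ∉ ({c : PointConfig ℂ × PointConfig ℂ | c.1.count (ball z₀ t) = 0} ∪
      {c | c.2.count (ball z₀ t) = 0}))
    (hii' : Disjoint (c.1 : Set ℂ) (c.2 : Set ℂ))
    (hi : (c.1 ∪ c.2) ∉ {u : PointConfig ℂ | ∃ z ∈ ball (0 : ℂ) L, ∀ p ∈ u, a ≤ dist z p})
    (hii : (c.1 ∪ c.2) ∉ {u : PointConfig ℂ | ∃ x ∈ PointConfig.tuples 2 u, x ∈ pairWindow L b})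
    (hiii : (c.1 ∪ c.2) ∉ {u : PointConfig ℂ | ∃ x ∈ PointConfig.tuples 4 u, x ∈ quadWindow L a l}) :
    ((c.1 : Set ℂ), (c.2 : Set ℂ)) ∈ noDefect W a b l := by
  have hu : ∀ {p : ℂ}, p ∈ (c.1 : Set ℂ) ∪ (c.2 : Set ℂ) → p ∈ c.1 ∪ c.2 := fun hp => hp
  refine ⟨⟨?_, ?_⟩, ?_, ?_, ?_, ?_⟩
  · obtain ⟨z, hz, hzD⟩ := (SmallCells.count_ne_zero_iff c.1 _).1 fun h => ho (Or.inl h)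
    exact ⟨z, hz, hD hzD⟩
  · obtain ⟨z, hz, hzD⟩ := (SmallCells.count_ne_zero_iff c.2 _).1 fun h => ho (Or.inr h)
    exact ⟨z, hz, hD hzD⟩
  · intro z hzW
    by_contra hcon
    push Not at hcon
    exact hi ⟨z, hWL hzW, fun p hp => hcon p hp⟩
  · intro p hp q hq hpW hpq
    by_contra hne
    refine hii ⟨![p, q], ⟨injective_nuclei_two hne, ?_⟩, ?_⟩
    · intro i
      fin_cases i
      · exact hu hp
      · exact hu hq
    · refine ⟨?_, ?_⟩
      · simpa using hWL hpW
      · simpa [mem_ball, dist_comm] using hpq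
  · intro p _ hpB hpW'
    exact Set.disjoint_left.1 hii' hpB hpW'
  · intro p hp q hq r hr r' hr' v v' hpW hpq hpr hqr hpr' hqr' hrr' e1 e2 hv e1' e2' hv'
    by_contra hlt
    push Not at hlt
    refine hiii ⟨![p, q, r, r'], ⟨injective_nuclei_four ⟨hpq, hpr, hqr, hpr', hqr', hrr'⟩, ?_⟩, ?_⟩
    · intro i
      fin_cases i
      · exact hu hp
      · exact hu hq
      · exact hu hr
      · exact hu hr'
    · refine ⟨?_, v, v', ?_⟩
      · simp only [mem_setOf_eq, Matrix.cons_val_zero, Matrix.cons_val_one, Matrix.head_cons,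
          Matrix.cons_val_two, Matrix.tail_cons]
        exact ⟨hWL hpW, hpq, hpr, hqr⟩
      · simp only [Matrix.cons_val_zero, Matrix.cons_val_one, Matrix.head_cons,
          Matrix.cons_val_two, Matrix.tail_cons, Matrix.cons_val_three]
        exact ⟨e1, e2, hv, e1', e2', hv', hlt.le⟩

/-! ### The failure probability at a fixed scale -/

/-- **Fixed-scale bound.**  For independent Poisson(Lebesgue) colour classes and a window
`W ⊆ B(0, L)` containing the disc `B(z₀, t)`, the (outer) probability of a defect in `W` at
thresholds `(a, b, l)` (`0 < l ≤ a`, `0 ≤ b`) is at most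
`2e^{-πt²} + (4L/a + 5)² e^{-πa²/2} + 2πL² · 2πb² + 2πL² · (2π(5a)²)² · 50π a l`
(union bound over the five bad events; (i)–(iii) for the superposed process of intensity
`2 · Lebesgue` via `superposition_holds` and `Measure.le_map_apply`). [folklore] -/
theorem measureReal_not_noDefect_le {PB PW : Measure (PointConfig ℂ)}
    (hB : IsPoissonPointProcess (volume : Measure ℂ) PB)
    (hW : IsPoissonPointProcess (volume : Measure ℂ) PW) {W : Set ℂ} {L t a b l : ℝ} {z₀ : ℂ}
    (hWL : W ⊆ ball (0 : ℂ) L) (hD : ball z₀ t ⊆ W) (hL : 0 ≤ L) (ht : 0 ≤ t) (ha : 0 < a)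
    (hb : 0 ≤ b) (hl : 0 < l) (hla : l ≤ a) :
    (PB.prod PW).real {c | ((c.1 : Set ℂ), (c.2 : Set ℂ)) ∉ noDefect W a b l} ≤
      2 * Real.exp (-(Real.pi * t ^ 2)) +
      (4 * L / a + 5) ^ 2 * Real.exp (-(Real.pi * a ^ 2 / 2)) +
      2 * Real.pi * L ^ 2 * (2 * Real.pi * b ^ 2) +
      2 * Real.pi * L ^ 2 * (2 * Real.pi * (5 * a) ^ 2) *
        (2 * Real.pi * (5 * a) ^ 2 * (50 * Real.pi * a * l)) := by
  haveI := hB.isProbabilityMeasure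
  haveI := hW.isProbabilityMeasure
  set Q : Measure (PointConfig ℂ) :=
    (PB.prod PW).map fun p : PointConfig ℂ × PointConfig ℂ => p.1 ∪ p.2 with hQdef
  have hQ : IsPoissonPointProcess (volume + volume : Measure ℂ) Q :=
    IsPoissonPointProcess.superposition_holds hB hW
  haveI := hQ.isProbabilityMeasure
  set Fo : Set (PointConfig ℂ × PointConfig ℂ) :=
    {c | c.1.count (ball z₀ t) = 0} ∪ {c | c.2.count (ball z₀ t) = 0} with hFo
  set Fd : Set (PointConfig ℂ × PointConfig ℂ) := {c | ¬ Disjoint (c.1 : Set ℂ) (c.2 : Set ℂ)}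
    with hFd
  set Fi : Set (PointConfig ℂ) := {u | ∃ z ∈ ball (0 : ℂ) L, ∀ p ∈ u, a ≤ dist z p} with hFi
  set Fii : Set (PointConfig ℂ) := {u | ∃ x ∈ PointConfig.tuples 2 u, x ∈ pairWindow L b}
    with hFii
  set Fiii : Set (PointConfig ℂ) := {u | ∃ x ∈ PointConfig.tuples 4 u, x ∈ quadWindow L a l}
    with hFiii
  have hsub : {c : PointConfig ℂ × PointConfig ℂ | ((c.1 : Set ℂ), (c.2 : Set ℂ)) ∉ noDefect W a b l}
      ⊆ Fo ∪ Fd ∪ {c | c.1 ∪ c.2 ∈ Fi ∪ Fii ∪ Fiii} := by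
    intro c hc
    by_contra hn
    simp only [mem_union, not_or, mem_setOf_eq] at hn
    obtain ⟨⟨hno, hnd⟩, ⟨hni, hnii⟩, hniii⟩ := hn
    rw [hFd, mem_setOf_eq, not_not] at hnd
    exact hc (mem_noDefect_of_not_bad c hWL hD hno hnd hni hnii hniii)
  have hFd0 : (PB.prod PW).real Fd = 0 := by
    rw [measureReal_def, hFd, measure_not_disjoint_eq_zero hB hW, ENNReal.toReal_zero]
  have h1 := measureReal_void_le hB hW z₀ ht
  have h2 := measureReal_setOf_union_le hB hW (Fi ∪ Fii ∪ Fiii)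
  have h3 := measureReal_emptyDisc_le hQ hL ha
  have h4 := measureReal_closePair_le hQ hL hb
  have h5 := measureReal_pseudoEdge_le hQ hL ha hl hla
  rw [← hQdef] at h2
  calc (PB.prod PW).real {c | ((c.1 : Set ℂ), (c.2 : Set ℂ)) ∉ noDefect W a b l}
      ≤ (PB.prod PW).real (Fo ∪ Fd ∪ {c | c.1 ∪ c.2 ∈ Fi ∪ Fii ∪ Fiii}) :=
        measureReal_mono hsub (measure_ne_top _ _)
    _ ≤ (PB.prod PW).real Fo + (PB.prod PW).real Fd +
          (PB.prod PW).real {c | c.1 ∪ c.2 ∈ Fi ∪ Fii ∪ Fiii} :=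
        (measureReal_union_le _ _).trans (add_le_add (measureReal_union_le _ _) le_rfl)
    _ ≤ (PB.prod PW).real Fo + 0 + (Q.real Fi + Q.real Fii + Q.real Fiii) := by
        rw [hFd0]
        refine add_le_add le_rfl (h2.trans ?_)
        exact (measureReal_union_le _ _).trans (add_le_add (measureReal_union_le _ _) le_rfl)
    _ ≤ _ := by rw [add_zero]; linarith

/-! ### Along the schedule `ε = δ^{1/8}` -/

/-- **The failure probability at mesh `δ ∈ (0, 1)` is below the majorant at `s = δ^{1/32}`.**
Rescale by `ε = δ^{1/8} = s⁴` (`not_mem_noDefect_of_smul`): the window becomes `ε⁻¹ • V ⊆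
B(0, L₀ s⁻⁴)` containing `B(ε⁻¹ z₀, t₀ s⁻⁴)`, the thresholds become `a = s⁻¹`, `b = s⁸`,
`l = s¹⁶`; then `measureReal_not_noDefect_le` and `bound_le_majorant`. [folklore] -/
theorem measureReal_fail_le_majorant {PB PW : Measure (PointConfig ℂ)}
    (hB : IsPoissonPointProcess (volume : Measure ℂ) PB)
    (hW : IsPoissonPointProcess (volume : Measure ℂ) PW) {V : Set ℂ} {L₀ t₀ : ℝ} {z₀ : ℂ}
    (hL₀ : 0 < L₀) (hVL : V ⊆ ball (0 : ℂ) L₀) (ht₀ : 0 < t₀) (hzV : ball z₀ t₀ ⊆ V) {δ : ℝ}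
    (hδ : 0 < δ) (hδ1 : δ < 1) :
    (PB.prod PW).real {c : PointConfig ℂ × PointConfig ℂ |
        (((δ ^ (1 / 8 : ℝ) : ℝ) : ℂ) • (c.1 : Set ℂ), ((δ ^ (1 / 8 : ℝ) : ℝ) : ℂ) • (c.2 : Set ℂ)) ∉
          noDefect V (cellRad δ) (sepRad δ) (edgeLen δ)} ≤
      2 * (((δ ^ (1 / 32 : ℝ))⁻¹) ^ 0 *
          Real.exp (-(Real.pi * t₀ ^ 2 * ((δ ^ (1 / 32 : ℝ))⁻¹) ^ 8))) +
      (4 * L₀ + 5) ^ 2 * (((δ ^ (1 / 32 : ℝ))⁻¹) ^ 6 *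
          Real.exp (-(Real.pi / 2 * ((δ ^ (1 / 32 : ℝ))⁻¹) ^ 2))) +
      4 * Real.pi ^ 2 * L₀ ^ 2 * (δ ^ (1 / 32 : ℝ)) ^ 8 +
      250000 * Real.pi ^ 4 * L₀ ^ 2 * (δ ^ (1 / 32 : ℝ)) ^ 3 := by
  haveI := hB.isProbabilityMeasure
  haveI := hW.isProbabilityMeasure
  set s : ℝ := δ ^ (1 / 32 : ℝ) with hsdef
  have hs : 0 < s := Real.rpow_pos_of_pos hδ _
  have hs1 : s ≤ 1 := Real.rpow_le_one hδ.le hδ1.le (by norm_num)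
  have hs' : s ≠ 0 := hs.ne'
  set ε : ℝ := δ ^ (1 / 8 : ℝ) with hεdef
  have hε : ε = s ^ 4 := by
    rw [hεdef, hsdef, show (1 / 8 : ℝ) = (1 / 32 : ℝ) * (4 : ℕ) by norm_num,
      Real.rpow_mul hδ.le, Real.rpow_natCast]
  have hεpos : 0 < ε := Real.rpow_pos_of_pos hδ _
  have hε' : (ε : ℂ) ≠ 0 := Complex.ofReal_ne_zero.2 hεpos.ne'
  have ha : cellRad δ / ε = s⁻¹ := by
    rw [cellRad, hε, hsdef, ← Real.rpow_natCast, ← Real.rpow_mul hδ.le, ← Real.rpow_sub hδ,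
      ← Real.rpow_neg hδ.le]
    norm_num
  have hb : sepRad δ / ε = s ^ 8 := by
    rw [sepRad, hε, hsdef, ← Real.rpow_natCast, ← Real.rpow_natCast, ← Real.rpow_mul hδ.le,
      ← Real.rpow_mul hδ.le, ← Real.rpow_sub hδ]
    norm_num
  have hl : edgeLen δ / ε = s ^ 16 := by
    rw [edgeLen, hε, hsdef, ← Real.rpow_natCast, ← Real.rpow_natCast, ← Real.rpow_mul hδ.le,
      ← Real.rpow_mul hδ.le, ← Real.rpow_sub hδ]
    norm_num
  have hεinv : ε⁻¹ = (s⁻¹) ^ 4 := by rw [hε, inv_pow]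
  -- the window at scale `ε⁻¹`
  have hWL : (ε : ℂ)⁻¹ • V ⊆ ball (0 : ℂ) (L₀ * (s⁻¹) ^ 4) := by
    intro z hz
    rw [Set.mem_smul_set_iff_inv_smul_mem₀ (inv_ne_zero hε'), inv_inv] at hz
    have h := hVL hz
    rw [mem_ball_zero_iff, norm_smul, Complex.norm_real, Real.norm_of_nonneg hεpos.le] at h
    rw [mem_ball_zero_iff, ← hεinv]
    rw [lt_mul_inv_iff₀ hεpos]  -- ‖z‖ < L₀ * ε⁻¹ ↔ ‖z‖ * ε < L₀
    linarith [mul_comm ε ‖z‖]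
  have hD : ball ((ε : ℂ)⁻¹ • z₀) (t₀ * (s⁻¹) ^ 4) ⊆ (ε : ℂ)⁻¹ • V := by
    have e : ball ((ε : ℂ)⁻¹ • z₀) (t₀ * (s⁻¹) ^ 4) = (ε : ℂ)⁻¹ • ball z₀ t₀ := by
      rw [_root_.smul_ball (inv_ne_zero hε'), norm_inv, Complex.norm_real,
        Real.norm_of_nonneg hεpos.le, hεinv, mul_comm]
    rw [e]
    exact Set.smul_set_mono hzV
  -- rescale, then the fixed-scale bound
  have hsub : {c : PointConfig ℂ × PointConfig ℂ |
      (((ε : ℝ) : ℂ) • (c.1 : Set ℂ), ((ε : ℝ) : ℂ) • (c.2 : Set ℂ)) ∉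
        noDefect V (cellRad δ) (sepRad δ) (edgeLen δ)} ⊆
      {c | ((c.1 : Set ℂ), (c.2 : Set ℂ)) ∉
        noDefect ((ε : ℂ)⁻¹ • V) (s⁻¹) (s ^ 8) (s ^ 16)} := by
    intro c hc
    have := not_mem_noDefect_of_smul hεpos hc
    rwa [ha, hb, hl] at this
  have hmain := measureReal_not_noDefect_le hB hW hWL hD
    (show (0 : ℝ) ≤ L₀ * (s⁻¹) ^ 4 by positivity) (show (0 : ℝ) ≤ t₀ * (s⁻¹) ^ 4 by positivity)
    (inv_pos.2 hs) (show (0 : ℝ) ≤ s ^ 8 by positivity) (show (0 : ℝ) < s ^ 16 by positivity)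
    (show s ^ 16 ≤ s⁻¹ from (pow_le_one₀ hs.le hs1).trans ((one_le_inv₀ hs).2 hs1))
  exact ((measureReal_mono hsub (measure_ne_top _ _)).trans hmain).trans
    (bound_le_majorant hL₀.le hs hs1)

end NoDefect

/-- **S2 — the bulk no-defect event has probability `→ 1`** (registered stub `stub_noDefect` of
the line `Sketch`, crux `SquareFromVoronoiHub`): for independent Poisson(Lebesgue) black and white
nuclei and a bounded window `V` with non-empty interior, the (outer) probability that the nuclei
dilated by `ε = δ^{1/8}` have a defect in `V` at thresholds `cellRad δ, sepRad δ, edgeLen δ` tends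
to `0` as `δ → 0⁺`: void probabilities for (o), (i), vanishing shared nuclei for (ii'), and first
moments (Markov + multivariate Mecke with configuration-independent integrands) for (ii), (iii),
after superposing the two colours; then the explicit majorant `→ 0` along `s = δ^{1/32}`.
[cite: BollobasRiordan2006, Ch. 8 §8.3] -/
theorem stub_noDefect : ∀ (PB PW : Measure (PointConfig ℂ)),
    IsPoissonPointProcess (volume : Measure ℂ) PB → IsPoissonPointProcess (volume : Measure ℂ) PW →
    ∀ V : Set ℂ, Bornology.IsBounded V → (interior V).Nonempty →
    Tendsto (fun δ : ℝ => (PB.prod PW).real {c |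
        (((δ ^ (1 / 8 : ℝ) : ℝ) : ℂ) • (c.1 : Set ℂ), ((δ ^ (1 / 8 : ℝ) : ℝ) : ℂ) • (c.2 : Set ℂ)) ∉
          noDefect V (cellRad δ) (sepRad δ) (edgeLen δ)})
      (𝓝[>] 0) (𝓝 0) := by
  intro PB PW hB hW V hV hint
  obtain ⟨L₀, hL₀, hVL⟩ := hV.subset_ball_lt 0 0
  obtain ⟨z₀, hz₀⟩ := hint
  obtain ⟨t₀, ht₀, hzV⟩ := Metric.mem_nhds_iff.1 (mem_interior_iff_mem_nhds.1 hz₀)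
  refine squeeze_zero' (Eventually.of_forall fun δ => measureReal_nonneg) ?_
    ((NoDefect.tendsto_majorant L₀ t₀ ht₀).comp NoDefect.tendsto_rpow_inv32_nhdsGT)
  filter_upwards [Ioo_mem_nhdsGT (zero_lt_one' ℝ)] with δ hδ
  exact NoDefect.measureReal_fail_le_majorant hB hW hL₀ hVL ht₀ hzV hδ.1 hδ.2

end Summit.CriticalPhenomena.CardyFormulaZ2.Cruxes.SquareFromVoronoiHub.VoronoiBlocks.Faithful

end
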